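import Mathlib
import Literature.Computability.QuantumComplexity.GaussianRank
import Summits.QuantumAdvantage.QuantumAdvantage.Theses.SpinorFlattening
import Summits.QuantumAdvantage.QuantumAdvantage.Theorems.GaussRankTwoCopies.Negative.TightFour

/-!
# Line `lagrangian-triple-rigidity` — CHECKED skeleton for the crux `SpinorFlattening.GaussRankTwoCopies`
# (stmt-QuantumAdvantage-1248; route `route-QuantumAdvantage-SpinorFlattening`, rank-5 crux `χ_G(M⊗M) ≥ 4`)

crux-plan seat `planner-cruxplan-stmt-QuantumAdvantage-1248-lagrangian-triple-ri-0`, 2026-08-16 (opening, round 1).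
Idea card `Cruxes/GaussRankTwoCopies/Ideas/lagrangian-triple-rigidity.md` (crux-ideate r1, ideator 3, v3) with the complete
paper proof `Cruxes/GaussRankTwoCopies/Ideator3Notes.md` §6; triage r1-1 / r1-2 / r1-3: pass × 3 ("complete, elementary,
Lean-cheapest; recommend as the PICKED line"). Line card: `Cruxes/GaussRankTwoCopies/Lines/lagrangian-triple-rigidity.md`.

## The line in one paragraph

STABILISER CONTAINMENT AT THE LIE-ALGEBRA LEVEL. If `M⊗M = Σ_{i<3} aᵢ gᵢ` with `gᵢ` pure spinors (annihilator
Lagrangians `Lᵢ ⊂ V = ℂ¹⁶`, `β` = the dot product on Majorana coefficient rows, `{c(u), c(v)} = 2β(u,v)`), then every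
quadratic Majorana operator `Q(X) = Σ X_{pq} c_p c_q` (`X` skew) that kills the three `gᵢ` kills `M⊗M`, i.e. lies in
`𝔨 := stab(M⊗M)`, and `𝔨 = stab(m)_A ⊕ stab(m)_B` is BLOCK-DIAGONAL for the `4|4` cut with both blocks killing the
annihilator-free, non-pure 4-mode vector `m = |M⟩` (S2 `stub_stabiliserBlockDiagonal`; input (T1) "`M` and `M⊗M` have
trivial annihilator" is kernel-checked in `Disproof.lean` §6). Reduce to EVEN terms first (S1 `stub_gaussianParity` + the
proved even re-decomposition). CASE D (S6 `stub_caseD`): two of the Lagrangians meet, `D := L₁ ∩ L₂ ≠ 0`, `d := dim D ∈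
{2,4,6}` (even: both spinors even; `d = 8`, zero coefficients and proportional terms are the ≤ 2-term case S5
`stub_twoTermFree`; `D ∩ L₃ = 0` by (T1)); then `W := L₃ ∩ D^⊥` has dimension exactly `8 − d`, `U := D ⊕ W` is totally
isotropic, and the bivectors `𝔞 := D ∧ W` (i) lie in `𝔨` by the LEVER `c_d c_w (Σ aᵢgᵢ) = 0` (PROVED here:
`pairProductAnnihilates`), (ii) multiply to zero pairwise (`𝔞 ⊂ Λ²U`), (iii) span `d(8−d) ≥ 12` dimensions; but by
block-diagonality the two block projections of `𝔞` are pairwise-annihilating families of skew `8×8` matrices whose quadratic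
operators kill `m`, and LEMMA C (S4 `stub_mutuallyAnnihilatingBound`) bounds such a family by `5` per block: `Σ im Xᵢ` is
isotropic, so the family sits in `Λ²I`, `dim ≤ 6` with equality only for `I` Lagrangian, and `Λ²I ⊄ stab(m)` because
`c_d c_{d'} m = 0 ∀ d,d' ∈ I` would put every `c_d m` in the vacuum LINE of `I` (S3 `stub_vacuumLine`, the single imported
spinor fact), forcing `c_d m = 0` for some `d ≠ 0` — (T1). So `12 ≤ dim 𝔞 ≤ 5 + 5`: impossible. CASE E (S7 `stub_caseE`):
the three Lagrangians are pairwise transverse; `V = L₂ ⊕ L₃ =: E ⊕ F`, `L₁ = graph φ`, `σ(e,e') := β(e, φe')` is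
symplectic on `E`, and for `X ∈ sp(E,σ)` the skew map `X̃ := X ⊕ (−X*)` preserves all three Lagrangians with trace `0`,
hence `Q(X̃)` kills all three `gᵢ` (`Q(Y)u_L = 2 tr(Y|_L) u_L` for `Y` preserving `L`: CAR only) and `X̃ ∈ 𝔨`; by S2 every
`X̃` preserves the coordinate block `V_A`, which is then an `sp(σ)`-submodule of `E ⊕ E*` meeting `F` trivially (an
isotropic 8-space cannot sit in the non-degenerate 8-space `V_A`), hence the graph of an equivariant `T : E → F`, and
`τ(e,e') := β(Te,e')` is an invariant bilinear form, `τ = cσ` by Schur (six self-contained lines), so `β|V_A = τ + τᵗ =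
0` — but `β|V_A` is non-degenerate. Cases D and E exhaust all triples: `χ_G(M⊗M) ≥ 4` (= 4 by `Negative.TightFour`).

## Composition (kernel-checked, no `sorry` of its own)

`GaussRankTwoCopies_of : GaussRankTwoCopies` is literally `twoCopies_of_cases S1 (S6 S2 S3 (S4 S3) S5) (S7 S2.mixed)`:
the dependency DAG of the line is checked by the kernel at that point — S3 (vacuum line) discharges the antecedent of S4
(Lemma C); S2, S3, S4∘S3, S5 discharge the four antecedents of S6 (Case D); the mixed-entry half of S2 discharges the
antecedent of S7 (Case E) — and `twoCopies_of_cases` (PROVED here) re-decomposes along the even projection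
(`even_redecomposition`, from S1; `evenProj_magicMPow_two` by `decide` on 8 bits) and splits on "some pair of the even
triple has a common nonzero annihilator" (Case D) versus "pairwise transverse" (Case E). DAG: S3 → S4; (S2, S3, S4, S5) →
S6; S2 → S7; (S1, S6, S7) → crux. Also PROVED here for the stub provers: the LEVER of Case D (`majv_anticomm` =
bilinear CAR, `pairProductAnnihilates`) and the bivector dictionary (`quadOp_wedge`: `Q(d wᵀ − w dᵀ) = c_d c_w − c_w c_d`,
`quadOp_wedge_mulVec_sum_eq_zero`: the lever in the form (T2) consumes); the isotropy glue of D0 / S1 (`majv_mul_self`,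
`isotropic_of_annihilates`, `orthogonal_of_annihilate`, `exists_isotropic_frame`: the `IsGaussian` frame meets the
hypotheses of (V)) and `proportional_of_vacuumLine` ((V) ⇒ "killed by the frame of a Gaussian `g` ⇒ multiple of `g`",
the form Case D (i) and the parity step consume). They are "orphans" for the file audit only because the stubs that
consume them are still `sorry`.

## Vocabulary policy (for the lead)

There is NO `def … : Prop` in this file. §1 holds seven short DATA definitions over tree vocabulary (`majv` = `c(v)` =
Disproof §6 `Annihilator.rowOp` = Ideator3Sketch `majv`; `quadOp` = `Q(X)` = Ideator3Sketch `quadOp`; `wireA`/`wireB`,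
`blockA`/`blockB` = the `4|4` cut of a `16×16` coefficient matrix; `evenProj` — identical to line e8-cartan-quotient's).
The four INPUT statements (T2) = S2, (V) = S3, (C) = Lemma C, (2T) = S5 recur VERBATIM as antecedents of the implication
stubs S4 (`(V) → (C)`), S6 (`(T2) → (V) → (C) → (2T) → Case D`) and S7 (`(T2).mixed → Case E`), so every registered
signature is landable as a Theorems statement over a definitions-only support module holding §1 (suggested
`Theorems/SpinorFlatteningGaussRankTwoCopiesLtrDefs.lean --supports stmt-QuantumAdvantage-1248`; precedents p73272 /
p72483 and the e8 line's Defs proposal). Suggested landing order: Defs; S3 (shared Fock infrastructure — also the input of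
e8-cartan-quotient's `stub_gaussianParity` = our S1, and of isotropy-defect-rank-four); S2; S4; S5; S1; S7; S6.
Conventions = the item's evidence codes (j009858 `rigidity_checks.py`, j010601 `triage_checks.py`, CHECKS.md r1-2,
j010554): JW Majoranas `majorana n j b` of `GaussianRank.lean`, `β` = `dotProduct` of coefficient rows (the CAR form:
`{c(u), c(v)} = 2 (u ⬝ᵥ v) • 1`), block A = wires 0–3, block B = wires 4–7 (`finProdFinEquiv (k, i) = i + 4k`).

## Disproof.lean used (tree `Cruxes/GaussRankTwoCopies/Disproof.lean`, cdisprove gen 1+2, read in full at start)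

* §1 `false_without_gaussianity` (landed `Negative.TightFour.gaussRankTwoCopies_false_without_gaussianity`, IMPORTED):
  honoured — the full Lagrangian (8 annihilators, `L^⊥ = L`) is used at S1 (parity), S3/S4 (vacuum line ⇒ Lemma C), S6
  (`dim W = 8 − d` needs `L₃^⊥ = L₃`; `d` even) and S7 (`L₁` is a graph over `L₂` only because all three are 8-dimensional).
* §1 `false_without_linearIndependence` (landed, IMPORTED): honoured at S1/S6/S7 — with fewer than 8 INDEPENDENT rows
  `W` shrinks and `d(8−d) ≥ 12` fails; §9's remark "7 rows would do for an even target" is consistent (the 8th annihilator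
  of an even pure spinor is automatic) and is not used.
* §2 `not_twoCopiesBound_four` / landed `gaussRankTwoCopies_tight_four`: respected — with four terms the lever needs
  `w ∈ L₃ ∩ L₄ ∩ D^⊥`, generically `0` (the four Fock corners: `(E_A⊕E_B) ∩ (F_A⊕F_B) = 0`); no stub says anything about
  4 terms, so the line does not prove too much.
* §5 `Parity.gaussianRank_not_multiplicative` (landed): honoured — parity is the FIRST step (S1 + `even_redecomposition`);
  for a mixed-parity factor like `|+⟩` block-diagonality (S2) fails and the lever is void, exactly as §5 demands; no stub
  is an instance of the refuted multiplicativity (checked against `Negative/TightFour.lean`, the only landed Negative module).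
* §6 (cycle 2) `Annihilator.magicMPow_two_annihilator_eq_zero` / `magicM_annihilator_eq_zero` / `magicM_not_isGaussian`:
  CONSUMED (kernel-checked there; filed by cdisprove for landing as `Negative/MajoranaBitFlip.lean` + `Negative/Annihilators.lean`)
  — they are input (T1) of S2, S4 and S6, which is why (T1) is not a stub here.
* §7 stub audit: Ideator3Sketch's `StabiliserBlockDiagonal` and `MutuallyAnnihilatingBound` "TRUE as typed" — S2 and
  S4 are those statements verbatim over `2 * 4` wires (S4 with the vacuum line as explicit antecedent); §7's remark that the bare case split
  `NonTransversePairFree`/`TransverseTripleFreeAnn` "has no independent attack surface" is ANSWERED by this cut: S6/S7 are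
  the reductions of the two cases to the named inputs S2–S5, each of which has its own attack surface and numerics.
* §3 `DistBound`: not claimed — the lever is blind to border rank (honest limit, card `Barriers`); border rank 4 is the
  business of lines e8-cartan-quotient / border-rank-four.
* `ledger negatives --problem QuantumAdvantage` (1615, 2202, 8592, 9863): unrelated; no stub restates a refuted statement.
-/

noncomputable section

namespace Summit.QuantumAdvantage.QuantumAdvantage.Cruxes.GaussRankTwoCopies.LagrangianTripleRigidity

set_option linter.dupNamespace false

open Literature.Computability.QuantumComplexity Literature.Computability.Cryptography Matrix
open scoped BigOperators

/-! ## §1 Vocabulary (data only; tree conventions) -/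

/-- The Clifford element `c(v) = Σ_p v_p c_p` of a coefficient row `v ∈ ℂ^{2n}` (rows of `IsGaussian`'s matrix `A`;
= `Annihilator.rowOp` of Disproof §6, `majv` of Ideator3Sketch). `{c(u), c(v)} = 2 (u ⬝ᵥ v) • 1` (`majv_anticomm`). -/
def majv (n : ℕ) (v : Fin n × Bool → ℂ) : Matrix (QReg n) (QReg n) ℂ :=
  ∑ p : Fin n × Bool, v p • majorana n p.1 p.2

/-- The quadratic Majorana operator `Q(X) = Σ_{p,q} X_{pq} c_p c_q` of a coefficient matrix `X` (for skew `X` the spin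
action of `X ∈ so(2n, ℂ)`; `Q(d wᵀ − w dᵀ) = c_d c_w − c_w c_d`, `quadOp_wedge`). -/
def quadOp (n : ℕ) (X : Matrix (Fin n × Bool) (Fin n × Bool) ℂ) : Matrix (QReg n) (QReg n) ℂ :=
  ∑ p : Fin n × Bool, ∑ q : Fin n × Bool, X p q • (majorana n p.1 p.2 * majorana n q.1 q.2)

/-- Wire `j` of block A (wires `0–3`) of the `2 * 4`-wire register. -/
def wireA (j : Fin 4) : Fin (2 * 4) := ⟨j.val, by have := j.isLt; omega⟩

/-- Wire `j` of block B (wires `4–7`) of the `2 * 4`-wire register. -/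
def wireB (j : Fin 4) : Fin (2 * 4) := ⟨j.val + 4, by have := j.isLt; omega⟩

/-- The `A`-block (Majorana labels of wires `0–3`) of a `16 × 16` coefficient matrix. -/
def blockA (X : Matrix (Fin (2 * 4) × Bool) (Fin (2 * 4) × Bool) ℂ) : Matrix (Fin 4 × Bool) (Fin 4 × Bool) ℂ :=
  Matrix.of fun p q => X (wireA p.1, p.2) (wireA q.1, q.2)

/-- The `B`-block (Majorana labels of wires `4–7`) of a `16 × 16` coefficient matrix. -/
def blockB (X : Matrix (Fin (2 * 4) × Bool) (Fin (2 * 4) × Bool) ℂ) : Matrix (Fin 4 × Bool) (Fin 4 × Bool) ℂ :=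
  Matrix.of fun p q => X (wireB p.1, p.2) (wireB q.1, q.2)

/-- Projection onto the even-parity sector: keep the amplitudes on even-weight bit strings (identical to line
e8-cartan-quotient's `evenProj`, so that ONE landing of the parity lemma serves both lines). -/
def evenProj (ψ : QReg (2 * 4) → ℂ) : QReg (2 * 4) → ℂ :=
  fun x => if (Finset.univ.filter (fun i => x i = true)).card % 2 = 0 then ψ x else 0

/-! ## §2 Registered stubs (the only `sorry`s of the line) -/

/-- **S1 `stub_gaussianParity`** [M; CAR algebra + S3 at `n = 2 * 4`]. Every Gaussian state on 8 qubits is even or odd.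
WHY TRUE: the annihilator space `L = {v : c(v) g = 0}` of `g ≠ 0` is isotropic (`c(v)² = (v ⬝ᵥ v) • 1`) of dimension 8
(`IsGaussian`; ≤ 8 by isotropy), its joint kernel is the line `ℂ g` (S3), and the parity operator `Z^{⊗8} = ∏ⱼ(−i c_{j,X}
c_{j,Y})` anticommutes with every `c(v)`, so `Z^{⊗8} g ∈ ℂ g`, `= ± g`. IDENTICAL to line e8-cartan-quotient's S1 (one
landing serves both). LEANS ON: `majorana_anticommutator`, `majorana_mul_majorana_of_ne`, `linearIndependent_majorana`. -/
theorem stub_gaussianParity :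
    ∀ g : QReg (2 * 4) → ℂ, IsGaussian g → evenProj g = g ∨ evenProj g = 0 := by
  sorry

/-- **S2 `stub_stabiliserBlockDiagonal`** [M; statement (T2), = Ideator3Sketch `StabiliserBlockDiagonal` over `2 * 4`
wires]. The Lie stabiliser of `M⊗M` in `so(16)` is BLOCK-DIAGONAL for the `4|4` cut and each block kills `m = |M⟩`.
WHY TRUE (Ideator3Notes §6.1, re-derived by all three triagers): `Q(X)(m⊗m) = (Q_A m)⊗m + m⊗(Q_B m) + 2 Σ_{a∈A,b∈B} X_{ab} (c_a m)⊗(c_b m)` (block-B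
Jordan–Wigner strings act as honest 4-qubit Majoranas on the even `m`); the three pieces live in the sectors
even⊗even, even⊗even, odd⊗odd; the 64 vectors `(c_a m)⊗(c_b m)` are independent because `v ↦ c(v) m` is injective
(Disproof §6 `magicM_annihilator_eq_zero`, kernel-checked), so `X_{ab} = 0`; then `Q_A m = μ m`, `Q_B m = −μ m`, and
`μ β(m,m) = β(Q_A m, m) = 0` because `Q_A` is skew for the invariant form `β(u,v) = uᵀ C₄ v`, `C₄ = X⊗Y⊗X⊗Y` (`C₄ c_p C₄ =
c_pᵀ`), while `β(m,m) = 2·½·⟨0000|C₄|1111⟩ ≠ 0`. LEANS ON: `majorana_apply`/`Annihilator.majorana_mulVec_basisState`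
(bit-flip engine), `magicMPow_succ` (`M⊗M = M ⊗ M`), `magicM_annihilator_eq_zero`. -/
theorem stub_stabiliserBlockDiagonal :
    ∀ X : Matrix (Fin (2 * 4) × Bool) (Fin (2 * 4) × Bool) ℂ, Xᵀ = -X →
      quadOp (2 * 4) X *ᵥ magicMPow 2 = 0 →
        (∀ p q : Fin (2 * 4) × Bool, p.1.val < 4 → 4 ≤ q.1.val → X p q = 0) ∧
          quadOp 4 (blockA X) *ᵥ magicM = 0 ∧ quadOp 4 (blockB X) *ᵥ magicM = 0 := by
  sorry

/-- **S3 `stub_vacuumLine`** [L; statement (V), vacuum uniqueness for general `n`; the single imported spinor-theoretic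
fact, DEEPEST stub]. The joint kernel of `c(d₁), …, c(d_n)` for `n` linearly independent, pairwise (and self-) orthogonal
rows `dᵢ ∈ ℂ^{2n}` (a Lagrangian of the CAR form) is at most a LINE in the `n`-qubit register (used at `n = 4` in S4 and at
`n = 2 * 4` in S1 and S6).
WHY TRUE (Chevalley 1954 III.1; Manivel 2009 §2.2; Bravyi 2005 §4): the `2n` Jordan–Wigner Majorana monomials are the
`4ⁿ` Pauli strings, which span `End((ℂ²)^{⊗n})`, so the register is the IRREDUCIBLE Clifford module; for a Lagrangian
`L = span d` pick an isotropic complement with dual basis `e` (`dᵢ ⬝ᵥ eⱼ = δᵢⱼ`, Witt); for `ψ ≠ 0` in the joint kernel the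
`2ⁿ` vectors `c(e_S) ψ` span a nonzero `Cl`-submodule, hence everything, hence are a basis; a second kernel vector
`ψ' = Σ λ_S c(e_S) ψ` has `λ_S = 0` for `S ≠ ∅` (apply `c(dᵢ)`, `i ∈ S`). Lean routes: induction on `n` peeling one mode
(`QReg (n+1) ≃ QReg n × Bool`, JW strings factor), or the trace route (`Πᵢ = ½ c(dᵢ) c(eᵢ)` are commuting idempotents with
`ker c(dᵢ) = im Πᵢ`, joint kernel `= im ∏ Πᵢ`, `tr ∏ Πᵢ = 2ⁿ · 2⁻ⁿ = 1` by trace-orthogonality of Majorana monomials).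
LEANS ON: `majorana_anticommutator`, `linearIndependent_majorana`, `trace_pauliString_mul_pauliString` (tree); Mathlib
`LinearMap.BilinForm` (Witt complement) or `Matrix.trace`. Shared consumer list: S1, S4, S6; e8 line S1; isotropy-defect. -/
theorem stub_vacuumLine :
    ∀ (n : ℕ) (d : Fin n → (Fin n × Bool → ℂ)), LinearIndependent ℂ d → (∀ i j, d i ⬝ᵥ d j = 0) →
      ∀ ψ ψ' : QReg n → ℂ, ψ ≠ 0 → (∀ i, majv n (d i) *ᵥ ψ = 0) → (∀ i, majv n (d i) *ᵥ ψ' = 0) →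
        ∃ c : ℂ, ψ' = c • ψ := by
  sorry

/-- **S4 `stub_mutuallyAnnihilatingBound`** [M; `(V) → (C)`: LEMMA C, the load-bearing bound, from the vacuum line;
(C) = Ideator3Sketch `MutuallyAnnihilatingBound`]. Six skew `8 × 8` matrices on ONE block that multiply to zero pairwise
(squares included) and whose quadratic operators all kill `|M⟩` are linearly dependent.
WHY TRUE (Ideator3Notes §6.3, re-derived ×3): for skew `X`, `ker X = (im X)^⊥` (dot product), so `Xᵢ Xⱼ = 0 ∀ i,j` makes
`I := Σ im Xᵢ` totally isotropic (`dim I ≤ 4`) and puts every `Xᵢ` in `Λ²_I := {X skew : im X ⊂ I, X|_{I^⊥} = 0} ≅ Λ²I`,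
`dim ≤ C(dim I, 2) ≤ 6`; six INDEPENDENT `Xᵢ` force `I` Lagrangian and `span Xᵢ = Λ²_I ∋ d d'ᵀ − d' dᵀ` for all
`d, d' ∈ I`, so (`quadOp_wedge`) `c_d c_{d'} m = 0 ∀ d, d' ∈ I`: each `c_d m` lies in the joint kernel of `c(I)`, a LINE by
the antecedent (`n = 4`; if all `c_d m = 0` we are done at once), so `d ↦ c_d m` is a linear map from the 4-dimensional `I`
into a line and kills some `d ≠ 0` — contradicting Disproof §6 `magicM_annihilator_eq_zero` ((T1) for `m`). The
hypothesis "all `i, j`" (squares included) IS used. LEANS ON: Mathlib `Matrix.transpose`, `dotProduct`, `LinearMap.range/ker`,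
`Submodule.finrank_le`, `LinearIndependent`; tree `magicM_annihilator_eq_zero` (Disproof §6, to be landed as
`Negative/Annihilators.lean`). -/
theorem stub_mutuallyAnnihilatingBound :
    (∀ (n : ℕ) (d : Fin n → (Fin n × Bool → ℂ)), LinearIndependent ℂ d → (∀ i j, d i ⬝ᵥ d j = 0) →
        ∀ ψ ψ' : QReg n → ℂ, ψ ≠ 0 → (∀ i, majv n (d i) *ᵥ ψ = 0) → (∀ i, majv n (d i) *ᵥ ψ' = 0) →
          ∃ c : ℂ, ψ' = c • ψ) →
      ∀ X : Fin 6 → Matrix (Fin 4 × Bool) (Fin 4 × Bool) ℂ,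
        (∀ i, (X i)ᵀ = -(X i)) → (∀ i j, X i * X j = 0) → (∀ i, quadOp 4 (X i) *ᵥ magicM = 0) →
          ¬ LinearIndependent ℂ X := by
  sorry

/-- **S5 `stub_twoTermFree`** [M; statement (2T) = Disproof `TwoCopiesBound IsGaussian 2`, `χ_G(M⊗M) ≥ 3`]. WHY TRUE:
the Clifford-multiplication flattening `F₂ : e_{a,b} ↦ c_a c_b ψ` (one Majorana per block) has rank `64` on `M⊗M` (the 64
vectors `(c_a m)⊗(c_b m)` are independent, same input as S2) but rank `≤ 29` on a Gaussian state (normal ordering;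
`flatteningDeficiency_two_eight`), and `2·29 = 58 < 64` (CudbyStrelchuk2023 §6; route support item FlatteningBoundExact
at `t = 2, K = 2, r = 2`). Flattening-free alternative inside this line (Ideator3Notes §6.4(iii)): two even terms with
Lagrangians `P₁ ≠ P₂`, `D₂ := P₁ ∩ P₂`; the pairwise-annihilating family `D₂ ∧ P₂` (`d₂ ≥ 2`, dim `28 − C(8−d₂,2) ≥ 13`)
or `P ∧ (P₂ ∩ P^⊥)` (`d₂ = 0`, dim 16) sits in `𝔨`, against `≤ 5 + 5` from S2 + S4. Numerics: best 2-term residual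
`0.500` (Disproof §3). LEANS ON: either route; `Negative.TightFour` shows the constant cannot be pushed to 4 terms. -/
theorem stub_twoTermFree :
    ∀ (b : Fin 2 → ℂ) (h : Fin 2 → QReg (2 * 4) → ℂ), (∀ i, IsGaussian (h i)) →
      magicMPow 2 ≠ ∑ i, b i • h i := by
  sorry

/-- **S6 `stub_caseD`** [L/XL; HARDEST by size — `(T2) → (V) → (C) → (2T) → Case D`]. For three EVEN Gaussian states
two of which share a nonzero annihilator, and any coefficients, `M⊗M ≠ Σ aᵢ gᵢ`. WHY TRUE (Ideator3Notes §6.4, re-derived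
×3; every finite input confirmed by j009858 / j010601 / CHECKS.md / j010554): suppose equality. (i) A zero coefficient, or
two terms with the same annihilator Lagrangian (then proportional, by (V) at `n = 2 * 4`), is a ≤ 2-term decomposition:
excluded by (2T). (ii) Otherwise let `Lᵢ := {v : c(v) gᵢ = 0}` — an 8-dimensional totally isotropic subspace with
`Lᵢ^⊥ = Lᵢ` (INTERNAL LEMMA D0 `AnnihilatorIsLagrangian`: isotropy from `c(v)² = (v⬝ᵥv)•1`, `dim ≥ 8` from `IsGaussian`,
`≤ 8` from isotropy in the non-degenerate `ℂ¹⁶`); `D := Lᵢ ∩ Lⱼ ∋ v ≠ 0` for the meeting pair, `d := dim D`;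
INTERNAL LEMMA D1 (parity of intersection): for even `gᵢ, gⱼ`, `d` is even — `gⱼ ∝ c(w₁)⋯c(w_{8−d}) gᵢ` for a basis `w` of
a complement of `D` in `Lⱼ` (it is nonzero and killed by `Lⱼ`; (V) at `n = 2 * 4`), and each `c(w)` flips the weight
parity (`Annihilator.majorana_mulVec_basisState`); so `d ∈ {2,4,6}` (`d = 8` is case (i)). (iii) `D ∩ L_k = 0` for the
third index `k` (a common annihilator of all three terms kills `M⊗M`: Disproof §6 `magicMPow_two_annihilator_eq_zero`), so
the pairing `L_k × D → ℂ` is perfect on the `D` side and `W := L_k ∩ D^⊥` has `dim W = 8 − d`, `W ∩ D = 0`, `U := D ⊕ W`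
totally isotropic. (iv) THE LEVER (`pairProductAnnihilates`, PROVED below, + `quadOp_wedge`): for `d ∈ D`, `w ∈ W` the skew
matrix `d wᵀ − w dᵀ` has `Q = c_d c_w − c_w c_d = 2 c_d c_w` killing `Σ aᵢgᵢ = M⊗M`; these matrices span `𝔞 ≅ D ⊗ W` of
dimension `d(8−d) ≥ 12` and multiply to zero pairwise (`𝔞 ⊂ Λ²U`, `U` isotropic). (v) By (T2) every element of `𝔞` is
block-diagonal with `Q_4(X_AA) m = Q_4(X_BB) m = 0`; products of block-diagonal matrices are computed blockwise, so
`blockA '' 𝔞` and `blockB '' 𝔞` are pairwise-annihilating subspaces of skew `8×8` matrices killing `m`, each of dimension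
`≤ 5` by (C), while `X ↦ (X_AA, X_BB)` is injective on `𝔞`: `12 ≤ dim 𝔞 ≤ 10`. LEANS ON: Mathlib `Submodule`/`finrank`
arithmetic, `LinearMap.BilinForm.orthogonal` (`finrank_add_finrank_orthogonal`), `LinearIndependent` of `d ⊗ w ↦ dwᵀ − wdᵀ`;
this file's `pairProductAnnihilates`, `quadOp_wedge`; Disproof §6 (T1) lemmas. -/
theorem stub_caseD :
    (∀ X : Matrix (Fin (2 * 4) × Bool) (Fin (2 * 4) × Bool) ℂ, Xᵀ = -X →
        quadOp (2 * 4) X *ᵥ magicMPow 2 = 0 →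
          (∀ p q : Fin (2 * 4) × Bool, p.1.val < 4 → 4 ≤ q.1.val → X p q = 0) ∧
            quadOp 4 (blockA X) *ᵥ magicM = 0 ∧ quadOp 4 (blockB X) *ᵥ magicM = 0) →
    (∀ (n : ℕ) (d : Fin n → (Fin n × Bool → ℂ)), LinearIndependent ℂ d → (∀ i j, d i ⬝ᵥ d j = 0) →
        ∀ ψ ψ' : QReg n → ℂ, ψ ≠ 0 → (∀ i, majv n (d i) *ᵥ ψ = 0) → (∀ i, majv n (d i) *ᵥ ψ' = 0) →
          ∃ c : ℂ, ψ' = c • ψ) →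
    (∀ X : Fin 6 → Matrix (Fin 4 × Bool) (Fin 4 × Bool) ℂ,
        (∀ i, (X i)ᵀ = -(X i)) → (∀ i j, X i * X j = 0) → (∀ i, quadOp 4 (X i) *ᵥ magicM = 0) →
          ¬ LinearIndependent ℂ X) →
    (∀ (b : Fin 2 → ℂ) (h : Fin 2 → QReg (2 * 4) → ℂ), (∀ i, IsGaussian (h i)) →
        magicMPow 2 ≠ ∑ i, b i • h i) →
      ∀ (a : Fin 3 → ℂ) (g : Fin 3 → QReg (2 * 4) → ℂ), (∀ i, IsGaussian (g i)) →
        (∀ i, evenProj (g i) = g i) →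
          (∃ i j : Fin 3, i ≠ j ∧ ∃ v : Fin (2 * 4) × Bool → ℂ,
              v ≠ 0 ∧ majv (2 * 4) v *ᵥ g i = 0 ∧ majv (2 * 4) v *ᵥ g j = 0) →
            magicMPow 2 ≠ ∑ i, a i • g i := by
  sorry

/-- **S7 `stub_caseE`** [L; `(T2).mixed → Case E`]. For three Gaussian states with pairwise TRANSVERSE annihilator
Lagrangians (no common nonzero annihilator for any pair) and any coefficients, `M⊗M ≠ Σ aᵢ gᵢ`. WHY TRUE (Ideator3Notes
§6.5, re-derived ×3; `dim ∩ stab(gᵢ) = 36 = sp(8)` confirmed j009858 / j010601 / Angelini 2011 Thm 5.1): put `E := L₂`,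
`F := L₃` (`V = E ⊕ F`, `β` pairs them perfectly), `L₁ = graph φ` with `σ(e,e') := β(e, φ e')` SYMPLECTIC (isotropy of
`L₁`; non-degenerate by `L₁ ∩ E = 0`). INTERNAL LEMMA E1 (CAR only, no vacuum uniqueness): if a skew `Y` preserves a
Lagrangian `L` then `Q(Y) u_L = 2 tr(Y|_L) u_L` for every `u_L` killed by `c(L)` (decompose `Y` in `Λ²L ⊕ (L ∧ F') ⊕ Λ²F'`
for a Lagrangian complement `F'` — which exists here BY HYPOTHESIS: `F' ∈ {E, F}`); for `X ∈ sp(E,σ)` the map `X̃ := X ⊕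
(−X*)` is skew, preserves `E`, `F`, `L₁` with traces `tr X = 0`, so `Q(X̃)` kills `g₁, g₂, g₃`, hence `Σ aᵢgᵢ = M⊗M`. By the
antecedent (T2) each `X̃` has zero `A|B` entries, i.e. preserves the coordinate block `V_A` (wires 0–3). INTERNAL LEMMA E2
(symplectic Schur, six lines): `E` is irreducible under `sp(σ)` (the maps `x ↦ σ(u,x) u` lie in `sp(σ)`), equivariant
endomorphisms are scalars, invariant bilinear forms are `ℂσ`. Then `V_A ∩ F` is a submodule of the irreducible `F ≅ E*`,
not all of `F` (an isotropic 8-space inside the 8-space `V_A` on which `β` = dot product is non-degenerate is impossible),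
so `V_A = graph T` for an equivariant `T : E → F`, `τ(e,e') := β(Te,e') = cσ(e,e')`, and `β|V_A(e+Te, e'+Te') = τ(e',e) +
τ(e,e') = 0`: `V_A` totally isotropic — absurd. LEANS ON: Mathlib `LinearMap.BilinForm` (restriction, non-degeneracy of the
dot product on a coordinate block), `Module.End` eigen-free Schur argument, `Matrix.trace`; tree CAR lemmas. -/
theorem stub_caseE :
    (∀ X : Matrix (Fin (2 * 4) × Bool) (Fin (2 * 4) × Bool) ℂ, Xᵀ = -X →
        quadOp (2 * 4) X *ᵥ magicMPow 2 = 0 →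
          ∀ p q : Fin (2 * 4) × Bool, p.1.val < 4 → 4 ≤ q.1.val → X p q = 0) →
      ∀ (a : Fin 3 → ℂ) (g : Fin 3 → QReg (2 * 4) → ℂ), (∀ i, IsGaussian (g i)) →
        (∀ i j : Fin 3, i ≠ j → ∀ v : Fin (2 * 4) × Bool → ℂ,
            majv (2 * 4) v *ᵥ g i = 0 → majv (2 * 4) v *ᵥ g j = 0 → v = 0) →
          magicMPow 2 ≠ ∑ i, a i • g i := by
  sorry

/-! ## §3 Proved parts of the line (real proofs, no `sorry` below this line) -/

/-! ### The lever of Case D: bilinear CAR and `c_d c_w` kills every combination -/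

/-- `c(d) c(w)` expanded as a double sum. -/
theorem majv_mul_majv (n : ℕ) (d w : Fin n × Bool → ℂ) :
    majv n d * majv n w =
      ∑ p : Fin n × Bool, ∑ q : Fin n × Bool, (d p * w q) • (majorana n p.1 p.2 * majorana n q.1 q.2) := by
  unfold majv
  rw [Finset.sum_mul]
  refine Finset.sum_congr rfl fun p _ => ?_
  rw [Finset.mul_sum]
  refine Finset.sum_congr rfl fun q _ => ?_
  rw [Matrix.smul_mul, Matrix.mul_smul, smul_smul]

/-- **Bilinear CAR**: `c(d) c(w) + c(w) c(d) = 2 (d ⬝ᵥ w) • 1`. -/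
theorem majv_anticomm (n : ℕ) (d w : Fin n × Bool → ℂ) :
    majv n d * majv n w + majv n w * majv n d =
      ((2 : ℂ) * (d ⬝ᵥ w)) • (1 : Matrix (QReg n) (QReg n) ℂ) := by
  rw [majv_mul_majv, majv_mul_majv,
    Finset.sum_comm (f := fun q p => (w q * d p) • (majorana n q.1 q.2 * majorana n p.1 p.2)),
    ← Finset.sum_add_distrib]
  have key : ∀ p q : Fin n × Bool,
      (d p * w q) • (majorana n p.1 p.2 * majorana n q.1 q.2) +
        (w q * d p) • (majorana n q.1 q.2 * majorana n p.1 p.2) =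
      if p = q then (d p * w q) • ((2 : ℂ) • (1 : Matrix (QReg n) (QReg n) ℂ)) else 0 := by
    intro p q
    rw [mul_comm (w q) (d p), ← smul_add, majorana_anticommutator]
    split_ifs <;> simp
  simp_rw [← Finset.sum_add_distrib, key, Finset.sum_ite_eq, Finset.mem_univ, if_true]
  rw [← Finset.sum_smul, smul_smul, dotProduct, mul_comm]

/-- `c(v)² = (v ⬝ᵥ v) • 1`: annihilating rows of a nonzero vector are ISOTROPIC (input of D0 / S1 / S3). -/
theorem majv_mul_self (n : ℕ) (v : Fin n × Bool → ℂ) :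
    majv n v * majv n v = (v ⬝ᵥ v) • (1 : Matrix (QReg n) (QReg n) ℂ) := by
  have h := majv_anticomm n v v
  rw [← two_smul ℂ (majv n v * majv n v), mul_smul] at h
  have h3 := congrArg (fun M : Matrix (QReg n) (QReg n) ℂ => (2 : ℂ)⁻¹ • M) h
  simpa only [inv_smul_smul₀ (two_ne_zero : (2 : ℂ) ≠ 0)] using h3

/-- An annihilating row of a nonzero vector is isotropic: `c(v) ψ = 0`, `ψ ≠ 0` ⇒ `v ⬝ᵥ v = 0`. -/
theorem isotropic_of_annihilates {n : ℕ} {v : Fin n × Bool → ℂ} {ψ : QReg n → ℂ} (hψ : ψ ≠ 0)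
    (h : majv n v *ᵥ ψ = 0) : v ⬝ᵥ v = 0 := by
  by_contra hv
  apply hψ
  have h2 : (majv n v * majv n v) *ᵥ ψ = 0 := by
    rw [← Matrix.mulVec_mulVec, h, Matrix.mulVec_zero]
  rw [majv_mul_self, Matrix.smul_mulVec, Matrix.one_mulVec] at h2
  exact (smul_eq_zero.mp h2).resolve_left hv

/-- Annihilating rows of a nonzero vector are pairwise ORTHOGONAL: `c(u) ψ = c(v) ψ = 0`, `ψ ≠ 0` ⇒ `u ⬝ᵥ v = 0`
(so the annihilator space of a Gaussian state is totally isotropic — input of D0 / S1 / S6, and the reason the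
`IsGaussian` frame satisfies the hypotheses of (V)). -/
theorem orthogonal_of_annihilate {n : ℕ} {u v : Fin n × Bool → ℂ} {ψ : QReg n → ℂ} (hψ : ψ ≠ 0)
    (hu : majv n u *ᵥ ψ = 0) (hv : majv n v *ᵥ ψ = 0) : u ⬝ᵥ v = 0 := by
  by_contra huv
  apply hψ
  have h2 : (majv n u * majv n v + majv n v * majv n u) *ᵥ ψ = 0 := by
    rw [Matrix.add_mulVec, ← Matrix.mulVec_mulVec, hv, Matrix.mulVec_zero, ← Matrix.mulVec_mulVec, hu,
      Matrix.mulVec_zero, add_zero]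
  rw [majv_anticomm, Matrix.smul_mulVec, Matrix.one_mulVec] at h2
  exact (smul_eq_zero.mp h2).resolve_left (mul_ne_zero two_ne_zero huv)

/-- The `IsGaussian` frame of a Gaussian state, in the shape of the hypotheses of (V): `n` linearly independent,
pairwise orthogonal rows whose Clifford elements `c(A k) = majv n (A k)` kill `g` (`majv` unfolds to the very sum in
`IsGaussian`). -/
theorem exists_isotropic_frame {n : ℕ} {g : QReg n → ℂ} (hg : IsGaussian g) :
    ∃ A : Fin n → (Fin n × Bool → ℂ), LinearIndependent ℂ A ∧ (∀ i j, A i ⬝ᵥ A j = 0) ∧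
      ∀ k, majv n (A k) *ᵥ g = 0 := by
  obtain ⟨hne, A, hA, hann⟩ := hg
  exact ⟨A, hA, fun i j => orthogonal_of_annihilate hne (hann i) (hann j), hann⟩

/-- (V) in the form Case D (i) consumes: a vector killed by the whole `IsGaussian` frame of a Gaussian `g` is a multiple
of `g` ("equal annihilator Lagrangians ⇒ proportional states"; also the parity step of S1 with `ψ' = Z^{⊗8} g`). -/
theorem proportional_of_vacuumLine
    (hV : ∀ (n : ℕ) (d : Fin n → (Fin n × Bool → ℂ)), LinearIndependent ℂ d → (∀ i j, d i ⬝ᵥ d j = 0) →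
      ∀ ψ ψ' : QReg n → ℂ, ψ ≠ 0 → (∀ i, majv n (d i) *ᵥ ψ = 0) → (∀ i, majv n (d i) *ᵥ ψ' = 0) →
        ∃ c : ℂ, ψ' = c • ψ)
    {n : ℕ} {g : QReg n → ℂ} (hg : IsGaussian g) {A : Fin n → (Fin n × Bool → ℂ)} (hA : LinearIndependent ℂ A)
    (hann : ∀ k, majv n (A k) *ᵥ g = 0) (ψ' : QReg n → ℂ) (hψ' : ∀ k, majv n (A k) *ᵥ ψ' = 0) :
    ∃ c : ℂ, ψ' = c • g :=
  hV n A hA (fun i j => orthogonal_of_annihilate hg.ne_zero (hann i) (hann j)) g ψ' hg.ne_zero hann hψ'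

/-- **THE LEVER** (Ideator3Notes §6.2): if `d` annihilates `ψ₀` and `ψ₁`, `w` annihilates `ψ₂` and `d ⊥ w`, then
`c(d) c(w)` kills every combination `Σ aᵢ ψᵢ` (three lines: `c_d c_w = −c_w c_d` on `ψ₀, ψ₁`, directly on `ψ₂`). -/
theorem pairProductAnnihilates (n : ℕ) (ψ : Fin 3 → QReg n → ℂ) (d w : Fin n × Bool → ℂ) (a : Fin 3 → ℂ)
    (hd0 : majv n d *ᵥ ψ 0 = 0) (hd1 : majv n d *ᵥ ψ 1 = 0) (hw2 : majv n w *ᵥ ψ 2 = 0) (hdw : d ⬝ᵥ w = 0) :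
    (majv n d * majv n w) *ᵥ (∑ i, a i • ψ i) = 0 := by
  have hanti : majv n d * majv n w = -(majv n w * majv n d) := by
    have h := majv_anticomm n d w
    rw [hdw, mul_zero, zero_smul] at h
    exact eq_neg_of_add_eq_zero_left h
  have h0 : (majv n d * majv n w) *ᵥ ψ 0 = 0 := by
    rw [hanti, Matrix.neg_mulVec, ← Matrix.mulVec_mulVec, hd0, Matrix.mulVec_zero, neg_zero]
  have h1 : (majv n d * majv n w) *ᵥ ψ 1 = 0 := by
    rw [hanti, Matrix.neg_mulVec, ← Matrix.mulVec_mulVec, hd1, Matrix.mulVec_zero, neg_zero]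
  have h2 : (majv n d * majv n w) *ᵥ ψ 2 = 0 := by
    rw [← Matrix.mulVec_mulVec, hw2, Matrix.mulVec_zero]
  rw [Fin.sum_univ_three, Matrix.mulVec_add, Matrix.mulVec_add, Matrix.mulVec_smul,
    Matrix.mulVec_smul, Matrix.mulVec_smul, h0, h1, h2]
  simp

/-- **Bivector dictionary**: the quadratic operator of the skew matrix `d wᵀ − w dᵀ` (the bivector `d ∧ w`) is the
commutator `c(d) c(w) − c(w) c(d)`; so the lever puts `d ∧ w` in the Lie stabiliser `{X : Q(X)(M⊗M) = 0}` of (T2). -/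
theorem quadOp_wedge (n : ℕ) (d w : Fin n × Bool → ℂ) :
    quadOp n (Matrix.vecMulVec d w - Matrix.vecMulVec w d) = majv n d * majv n w - majv n w * majv n d := by
  rw [majv_mul_majv, majv_mul_majv, ← Finset.sum_sub_distrib]
  unfold quadOp
  refine Finset.sum_congr rfl fun p _ => ?_
  rw [← Finset.sum_sub_distrib]
  refine Finset.sum_congr rfl fun q _ => ?_
  rw [Matrix.sub_apply, Matrix.vecMulVec_apply, Matrix.vecMulVec_apply, sub_smul, mul_comm (w p) (d q)]

/-- The lever in the form consumed through (T2): for `d ⊥ w` with `d` killing `ψ₀, ψ₁` and `w` killing `ψ₂`,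
`Q(d wᵀ − w dᵀ)` kills `Σ aᵢ ψᵢ`. -/
theorem quadOp_wedge_mulVec_sum_eq_zero (n : ℕ) (ψ : Fin 3 → QReg n → ℂ) (d w : Fin n × Bool → ℂ)
    (a : Fin 3 → ℂ) (hd0 : majv n d *ᵥ ψ 0 = 0) (hd1 : majv n d *ᵥ ψ 1 = 0) (hw2 : majv n w *ᵥ ψ 2 = 0)
    (hdw : d ⬝ᵥ w = 0) :
    quadOp n (Matrix.vecMulVec d w - Matrix.vecMulVec w d) *ᵥ (∑ i, a i • ψ i) = 0 := by
  have hanti : majv n w * majv n d = -(majv n d * majv n w) := by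
    have h := majv_anticomm n d w
    rw [hdw, mul_zero, zero_smul] at h
    exact (neg_eq_of_add_eq_zero_right h).symm
  rw [quadOp_wedge, hanti, sub_neg_eq_add, ← two_smul ℂ (majv n d * majv n w), Matrix.smul_mulVec,
    pairProductAnnihilates n ψ d w a hd0 hd1 hw2 hdw, smul_zero]

/-! ### Even projection (verbatim from line e8-cartan-quotient §3, same `evenProj`) -/

theorem evenProj_add (φ ψ : QReg (2 * 4) → ℂ) : evenProj (φ + ψ) = evenProj φ + evenProj ψ := by
  funext x
  simp only [evenProj, Pi.add_apply]
  split_ifs <;> simp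

theorem evenProj_smul (c : ℂ) (ψ : QReg (2 * 4) → ℂ) : evenProj (c • ψ) = c • evenProj ψ := by
  funext x
  simp only [evenProj, Pi.smul_apply, smul_eq_mul]
  split_ifs <;> simp

theorem evenProj_sum_three (f : Fin 3 → QReg (2 * 4) → ℂ) :
    evenProj (∑ i, f i) = ∑ i, evenProj (f i) := by
  rw [Fin.sum_univ_three, Fin.sum_univ_three, evenProj_add, evenProj_add]

/-- Block-constant strings of eight bits have even weight (`decide` over the eight bits). -/
theorem card_even_of_blockConst_vec (b₀ b₁ b₂ b₃ b₄ b₅ b₆ b₇ : Bool) :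
    (∀ k : Fin 2, ∀ i : Fin 4,
        (fun w : Fin (2 * 4) => ![b₀, b₁, b₂, b₃, b₄, b₅, b₆, b₇] w) (finProdFinEquiv (k, i)) =
          (fun w : Fin (2 * 4) => ![b₀, b₁, b₂, b₃, b₄, b₅, b₆, b₇] w) (finProdFinEquiv (k, (0 : Fin 4)))) →
      (Finset.univ.filter (fun i : Fin (2 * 4) =>
          (fun w : Fin (2 * 4) => ![b₀, b₁, b₂, b₃, b₄, b₅, b₆, b₇] w) i = true)).card % 2 = 0 := by
  revert b₀ b₁ b₂ b₃ b₄ b₅ b₆ b₇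
  decide

/-- Every label on `2 * 4` wires is the vector of its eight values. -/
theorem eq_vec8 (x : QReg (2 * 4)) :
    x = fun w : Fin (2 * 4) => ![x 0, x 1, x 2, x 3, x 4, x 5, x 6, x 7] w := by
  funext w
  fin_cases w <;> rfl

/-- Block-constant labels on `2 * 4` wires have even weight. -/
theorem card_even_of_blockConst (x : QReg (2 * 4))
    (hbc : ∀ k : Fin 2, ∀ i : Fin 4, x (finProdFinEquiv (k, i)) = x (finProdFinEquiv (k, (0 : Fin 4)))) :
    (Finset.univ.filter (fun i : Fin (2 * 4) => x i = true)).card % 2 = 0 := by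
  revert hbc
  rw [eq_vec8 x]
  exact card_even_of_blockConst_vec _ _ _ _ _ _ _ _

/-- `|M⟩^{⊗2}` is even. -/
theorem evenProj_magicMPow_two : evenProj (magicMPow 2) = magicMPow 2 := by
  classical
  funext x
  simp only [evenProj]
  split_ifs with hx
  · rfl
  · rw [magicMPow_apply, if_neg]
    intro hbc
    exact hx (card_even_of_blockConst x hbc)

/-- The vacuum `|0⁸⟩` is even. -/
theorem evenProj_zeroState : evenProj (zeroState (2 * 4)) = zeroState (2 * 4) := by
  funext x
  simp only [evenProj]
  split_ifs with hx
  · rfl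
  · rw [zeroState, basisState_apply, if_neg]
    intro h
    apply hx
    rw [h]
    decide

/-- S1 ⇒ the even projection of ANY 3-term Gaussian combination is a 3-term combination of EVEN Gaussian states
(odd terms are replaced by `0 • |0⁸⟩`). -/
theorem even_redecomposition
    (h1 : ∀ g : QReg (2 * 4) → ℂ, IsGaussian g → evenProj g = g ∨ evenProj g = 0)
    (a : Fin 3 → ℂ) (g : Fin 3 → QReg (2 * 4) → ℂ) (hg : ∀ i, IsGaussian (g i)) :
    ∃ (a' : Fin 3 → ℂ) (g' : Fin 3 → QReg (2 * 4) → ℂ), (∀ i, IsGaussian (g' i)) ∧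
      (∀ i, evenProj (g' i) = g' i) ∧ ∑ i, a' i • g' i = evenProj (∑ i, a i • g i) := by
  classical
  refine ⟨fun i => if evenProj (g i) = g i then a i else 0,
    fun i => if evenProj (g i) = g i then g i else zeroState (2 * 4), ?_, ?_, ?_⟩
  · intro i
    by_cases h : evenProj (g i) = g i
    · simp only [if_pos h]; exact hg i
    · simp only [if_neg h]; exact zeroState_isGaussian _
  · intro i
    by_cases h : evenProj (g i) = g i
    · simp only [if_pos h]; exact h
    · simp only [if_neg h]; exact evenProj_zeroState
  · rw [evenProj_sum_three]
    refine Finset.sum_congr rfl fun i _ => ?_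
    rw [evenProj_smul]
    by_cases h : evenProj (g i) = g i
    · simp only [if_pos h]; rw [h]
    · have h0 : evenProj (g i) = 0 := (h1 (g i) (hg i)).resolve_left h
      simp only [if_neg h]; rw [h0, smul_zero, zero_smul]

/-! ### The case split -/

/-- **Parity reduction + case split**: the parity statement (S1), the EVEN Case D statement (conclusion of S6) and the
Case E statement (conclusion of S7) prove `χ_G(M⊗M) ≥ 4` in the named form over `IsGaussian` / `magicMPow`
(= Disproof `TwoCopiesBound IsGaussian 3`): re-decompose along the even projection (`even_redecomposition`), then
either some pair of the even triple shares a nonzero annihilator (Case D) or every pair is transverse (Case E). -/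
theorem twoCopies_of_cases
    (h1 : ∀ g : QReg (2 * 4) → ℂ, IsGaussian g → evenProj g = g ∨ evenProj g = 0)
    (hD : ∀ (a : Fin 3 → ℂ) (g : Fin 3 → QReg (2 * 4) → ℂ), (∀ i, IsGaussian (g i)) →
      (∀ i, evenProj (g i) = g i) →
        (∃ i j : Fin 3, i ≠ j ∧ ∃ v : Fin (2 * 4) × Bool → ℂ,
            v ≠ 0 ∧ majv (2 * 4) v *ᵥ g i = 0 ∧ majv (2 * 4) v *ᵥ g j = 0) →
          magicMPow 2 ≠ ∑ i, a i • g i)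
    (hE : ∀ (a : Fin 3 → ℂ) (g : Fin 3 → QReg (2 * 4) → ℂ), (∀ i, IsGaussian (g i)) →
      (∀ i j : Fin 3, i ≠ j → ∀ v : Fin (2 * 4) × Bool → ℂ,
          majv (2 * 4) v *ᵥ g i = 0 → majv (2 * 4) v *ᵥ g j = 0 → v = 0) →
        magicMPow 2 ≠ ∑ i, a i • g i) :
    ∀ (a : Fin 3 → ℂ) (g : Fin 3 → QReg (2 * 4) → ℂ), (∀ i, IsGaussian (g i)) →
      magicMPow 2 ≠ ∑ i, a i • g i := by
  intro a g hg heq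
  obtain ⟨a', g', hg', he', hsum⟩ := even_redecomposition h1 a g hg
  have heq' : magicMPow 2 = ∑ i, a' i • g' i := by
    rw [hsum, ← heq, evenProj_magicMPow_two]
  by_cases h : ∃ i j : Fin 3, i ≠ j ∧ ∃ v : Fin (2 * 4) × Bool → ℂ,
      v ≠ 0 ∧ majv (2 * 4) v *ᵥ g' i = 0 ∧ majv (2 * 4) v *ᵥ g' j = 0
  · exact hD a' g' hg' he' h heq'
  · refine hE a' g' hg' ?_ heq'
    intro i j hij v hvi hvj
    by_contra hv
    exact h ⟨i, j, hij, v, hv, hvi, hvj⟩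

/-! ## §4 The skeleton theorem: the seven stubs prove the crux BY NAME -/

/-- **`GaussRankTwoCopies` from the seven registered stubs** — the composition `S1 → … → S7 → crux`, with the
dependency DAG checked by the kernel right here: S3 discharges the antecedent of S4; S2, S3, S4∘S3, S5 discharge the
antecedents of S6 (Case D); the mixed-entry half of S2 discharges the antecedent of S7 (Case E); S1 + the two cases give
the crux through `twoCopies_of_cases`. The route decl unfolds (three `let`s, `Iff.rfl`-identical to the named API:
Disproof §0 `crux_iff`) to `∀ a g, (∀ i, IsGaussian (g i)) → magicMPow 2 ≠ Σ aᵢ • gᵢ`. The only gaps the audit sees are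
the seven `sorry`s of §2. -/
theorem GaussRankTwoCopies_of :
    Summit.QuantumAdvantage.QuantumAdvantage.Theses.SpinorFlattening.GaussRankTwoCopies := by
  intro a g hg
  exact twoCopies_of_cases stub_gaussianParity
    (stub_caseD stub_stabiliserBlockDiagonal stub_vacuumLine (stub_mutuallyAnnihilatingBound stub_vacuumLine)
      stub_twoTermFree)
    (stub_caseE fun X hX hQ => (stub_stabiliserBlockDiagonal X hX hQ).1) a g hg

end Summit.QuantumAdvantage.QuantumAdvantage.Cruxes.GaussRankTwoCopies.LagrangianTripleRigidity

end
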